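import Literature.MathematicalPhysics.QuantumFieldTheory.Balaban1983to89.B12Decay510Gauge
import Literature.MathematicalPhysics.QuantumFieldTheory.Balaban1983to89.Beta.RemainderLocality

/-!
# [I] §4–§5 bookkeeping, GENERIC: the TWO-VOLUME comparison of (4.35)-shaped kernels as a `KernelBound`, masked-kernel TAILS (large ∕ far domains), label pull-back,
# and the three-term split of a volume increment — the volume-blind combinatorics behind «this limit exists» ([I] (1.21) p.264 with (1.7), (1.18), (4.35)–(4.37), (5.10))

Generic lemmas over `B12Decay510.SiteGeometry` ∕ `KernelBound` ∕ `mixedDeriv` (no record names, no route objects).  AUTHORSHIP: ◇ lens-1 g6 «cauchy-analytic»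
(`ymgap-nodeO-lens-1`), HOME sketch `pub/ym-nodeO-ideate/nodeO-cover/LENS-1-D4VolumeCauchy-v1.6.lean` (b91793d244d055dc) §7–§9, landed VERBATIM (namespace and this header only
differ) by porter PTC-1 g3 (`ymgap-nodeO-port-PTC-1`) on ★★★ director-ym g21 №527 (c) («the g6 §7–§9 generic lemmas may land as a Literature-side helper when idle»).
* §7 (4a) `kernelBound_twoVolume_of_size` ∕ `_of_size_subadd` ∕ `_of_repr435` ∕ `_of_gauge`, `lipschitz_of_bilinear_cauchy`, `mixedDeriv_sub_mixedDeriv`, `mixedDeriv_nextMember_eq`: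
  two (4.35)-shaped kernels with the SAME volume-blind form, Lipschitz-bilinear with Cauchy constant `A e^{−κ d(X)}`, responses decaying and AGREEING up to `η e^{−(δ₀∕2)dist}` ⟹ the
  DIFFERENCE kernel obeys `KernelBound` with constant `∝ η` (the (R4ᴰ)-type rate sits in the constant).
* §8 (4c) `maskKernel`, `kernelBound_maskKernel_of_large ∕ _of_far`, `comapLabels`, `kernelBound_comapLabels`: the TAILS of a volume increment are masked `KernelBound`s with a small constant.
* §9 `abs_sum_next_sub_sum_le_three`: the two-volume increment SPLITS into the matched part and the two tails.
HONEST: elementary real analysis ∕ finite-sum bookkeeping; nothing of Bałaban's estimates is asserted, ported or discharged; no record object appears.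
-/

noncomputable section

open Filter Topology
open scoped BigOperators Matrix.Norms.L2Operator

namespace Literature.MathematicalPhysics.QuantumFieldTheory.Balaban1983to89.B12Decay510TwoVolume

open Literature.MathematicalPhysics.QuantumFieldTheory.Balaban1983to89

/-! ## §7 ★ (4a) generic: the TWO-VOLUME comparison of a (4.35)-shaped kernel is again a `KernelBound` — the (R4ᴰ) rate `η` sits in the constant -/

section TwoVolume

open Literature.MathematicalPhysics.QuantumFieldTheory.Balaban1983to89.B12Decay510 (SiteGeometry KernelBound mixedDeriv)
open Literature.MathematicalPhysics.QuantumFieldTheory.Balaban1983to89.Beta.RemainderLocality (mixedDeriv_eq_fderiv_fderiv differentiableAt_fderiv_of_analyticAt mixedDeriv_comp_clm)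
open Literature.MathematicalPhysics.QuantumFieldTheory.Balaban1983to89.B12Decay510Gauge (norm_mixedDeriv_le_gauge)

variable {S : LocDomainSys} {C : B12.CubeCover S} {Λ : Type*}

/-- ★ **(4a) AS A KERNEL BOUND — SIZE-FUNCTIONAL FORM** (any nonnegative «size» `g_X` on the coordinate space: a norm, or the GAUGE of print's (4.4) domain as in the tree's
`B12Decay510Gauge.kernelBound_of_gauge`).  Two (4.35)-shaped kernels `E2 X x y = Q_X(h_X(x), h_X(y))` (member `n`) and `E2′ X x y = Q_X(h′_X(x), h′_X(y))` (member `n + 1`, chart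
inputs pulled back by `restrictCLM`) with the SAME form `Q_X` (volume-blind pieces: `PieceVolIndep` + (R5)), `Q_X` Lipschitz-bilinear with the Cauchy constant `A e^{−κ d_j(X)}`
((1.18) + (4.3)–(4.5)), member `n`'s response decaying at rate `δ₀` ((R1ᴰ)), the pulled-back response bounded at rate `δ₀∕2` (a CONSEQUENCE of (R1ᴰ) + (R4ᴰ) for a subadditive size,
`kernelBound_twoVolume_of_size_subadd`), and the responses AGREEING up to `η · e^{−(δ₀∕2)dist(x, X)}` ((R4ᴰ): `η = C₉ e^{−δ₀N∕2}`) ⟹ the DIFFERENCE kernel obeys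
`B12Decay510.KernelBound` with constant `Aη(B₃′ + B₃)` at rates `(κ, δ₀∕2)`; so the decay join's resummation `B12Decay510.abs_twoPoint_le ∕ sum_abs_le` applies VERBATIM to the
volume increment: `|Σ_X (E2′ − E2)(X, x, y)| ≤ Aη(B₃′ + B₃) · e^{δ₁Mc₁}K₀K₁ · e^{−δ₁ρ(x,y)}` = the (S≈) input of §3 with `C r^K := const · e^{−δ₀N(K)∕2}`.  Elementary.
[cite: Balaban1987RG1, (4.35) p.290, (4.5) p.282, (1.21) p.264; Balaban1985Variational, Prop. 9 p.309] -/
theorem kernelBound_twoVolume_of_size (G : SiteGeometry C Λ) {W : S.Dom → Type*} [∀ X, AddCommGroup (W X)] (g : (X : S.Dom) → W X → ℝ) (hg : ∀ X a, 0 ≤ g X a)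
    (Q : (X : S.Dom) → W X → W X → ℝ) (h h' : (X : S.Dom) → Λ → W X) (E2 E2' : S.Dom → Λ → Λ → ℝ) {A B₃ B₃' κ δ₀ η : ℝ}
    (hA : 0 ≤ A) (hB₃ : 0 ≤ B₃) (hη : 0 ≤ η) (hδ₀ : 0 ≤ δ₀)
    (hrepr : ∀ X x y, E2 X x y = Q X (h X x) (h X y)) (hrepr' : ∀ X x y, E2' X x y = Q X (h' X x) (h' X y))
    (hQ : ∀ X (a b a' b' : W X), |Q X a' b' - Q X a b| ≤ A * Real.exp (-κ * S.dj X) * (g X (a' - a) * g X b' + g X a * g X (b' - b)))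
    (hh : ∀ X x, g X (h X x) ≤ B₃ * Real.exp (-δ₀ * G.distD x X)) (hh' : ∀ X x, g X (h' X x) ≤ B₃' * Real.exp (-(δ₀ / 2) * G.distD x X))
    (hcmp : ∀ X x, g X (h' X x - h X x) ≤ η * Real.exp (-(δ₀ / 2) * G.distD x X)) :
    KernelBound G (fun X x y => E2' X x y - E2 X x y) (A * η * (B₃' + B₃)) κ (δ₀ / 2) := by
  intro X x y
  simp only [hrepr, hrepr']
  set eκ := Real.exp (-κ * S.dj X)
  set ex := Real.exp (-(δ₀ / 2) * G.distD x X)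
  set ey := Real.exp (-(δ₀ / 2) * G.distD y X)
  have hex : Real.exp (-δ₀ * G.distD x X) ≤ ex := Real.exp_le_exp.mpr (by nlinarith [G.distD_nonneg x X])
  have h1 : g X (h' X x - h X x) ≤ η * ex := hcmp X x
  have h2 : g X (h' X y - h X y) ≤ η * ey := hcmp X y
  have h3 : g X (h' X y) ≤ B₃' * ey := hh' X y
  have h4 : g X (h X x) ≤ B₃ * ex := (hh X x).trans (mul_le_mul_of_nonneg_left hex hB₃)
  have hAκ : 0 ≤ A * eκ := mul_nonneg hA (Real.exp_pos _).le
  calc |Q X (h' X x) (h' X y) - Q X (h X x) (h X y)|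
      ≤ A * eκ * (g X (h' X x - h X x) * g X (h' X y) + g X (h X x) * g X (h' X y - h X y)) := hQ X _ _ _ _
    _ ≤ A * eκ * ((η * ex) * (B₃' * ey) + (B₃ * ex) * (η * ey)) := by
        refine mul_le_mul_of_nonneg_left (add_le_add ?_ ?_) hAκ
        · exact mul_le_mul h1 h3 (hg X _) (mul_nonneg hη (Real.exp_pos _).le)
        · exact mul_le_mul h4 h2 (hg X _) (mul_nonneg hB₃ (Real.exp_pos _).le)
    _ = A * η * (B₃' + B₃) * eκ * ex * ey := by ring

/-- ★ **(4a), SUBADDITIVE SIZE** (norms; gauges of convex absorbent sets): the bound on the pulled-back response `h′` is NOT an extra input — `g(h′) ≤ g(h) + g(h′ − h) ≤ (B₃ + η)e^{−(δ₀∕2)dist}`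
from (R1ᴰ) at member `n` and (R4ᴰ) alone (no member-`n + 1` decay transfer, no domain∕distance compatibility of the embedding needed).  Constant `Aη((B₃ + η) + B₃)`.
[cite: Balaban1987RG1, (4.35) p.290, (4.5) p.282, (1.21) p.264; Balaban1985Variational, Prop. 9 p.309] -/
theorem kernelBound_twoVolume_of_size_subadd (G : SiteGeometry C Λ) {W : S.Dom → Type*} [∀ X, AddCommGroup (W X)] (g : (X : S.Dom) → W X → ℝ) (hg : ∀ X a, 0 ≤ g X a)
    (hg_add : ∀ X a b, g X (a + b) ≤ g X a + g X b)
    (Q : (X : S.Dom) → W X → W X → ℝ) (h h' : (X : S.Dom) → Λ → W X) (E2 E2' : S.Dom → Λ → Λ → ℝ) {A B₃ κ δ₀ η : ℝ}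
    (hA : 0 ≤ A) (hB₃ : 0 ≤ B₃) (hη : 0 ≤ η) (hδ₀ : 0 ≤ δ₀)
    (hrepr : ∀ X x y, E2 X x y = Q X (h X x) (h X y)) (hrepr' : ∀ X x y, E2' X x y = Q X (h' X x) (h' X y))
    (hQ : ∀ X (a b a' b' : W X), |Q X a' b' - Q X a b| ≤ A * Real.exp (-κ * S.dj X) * (g X (a' - a) * g X b' + g X a * g X (b' - b)))
    (hh : ∀ X x, g X (h X x) ≤ B₃ * Real.exp (-δ₀ * G.distD x X))
    (hcmp : ∀ X x, g X (h' X x - h X x) ≤ η * Real.exp (-(δ₀ / 2) * G.distD x X)) :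
    KernelBound G (fun X x y => E2' X x y - E2 X x y) (A * η * ((B₃ + η) + B₃)) κ (δ₀ / 2) := by
  refine kernelBound_twoVolume_of_size G g hg Q h h' E2 E2' hA hB₃ hη hδ₀ hrepr hrepr' hQ hh (fun X x => ?_) hcmp
  have hex : Real.exp (-δ₀ * G.distD x X) ≤ Real.exp (-(δ₀ / 2) * G.distD x X) := Real.exp_le_exp.mpr (by nlinarith [G.distD_nonneg x X])
  calc g X (h' X x) = g X (h X x + (h' X x - h X x)) := by rw [add_sub_cancel]
    _ ≤ g X (h X x) + g X (h' X x - h X x) := hg_add X _ _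
    _ ≤ B₃ * Real.exp (-δ₀ * G.distD x X) + η * Real.exp (-(δ₀ / 2) * G.distD x X) := add_le_add (hh X x) (hcmp X x)
    _ ≤ B₃ * Real.exp (-(δ₀ / 2) * G.distD x X) + η * Real.exp (-(δ₀ / 2) * G.distD x X) := by
        have := mul_le_mul_of_nonneg_left hex hB₃
        linarith
    _ = (B₃ + η) * Real.exp (-(δ₀ / 2) * G.distD x X) := by ring

/-- ★ **(4a) AS A KERNEL BOUND — NORM FORM** (`g_X := ‖·‖`; matches the tree's `B12Decay510.kernelBound_of_repr435`; `h′`'s bound derived). [cite: Balaban1987RG1, (4.35) p.290, (4.5) p.282, (1.21) p.264] -/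
theorem kernelBound_twoVolume_of_repr435 (G : SiteGeometry C Λ) {W : S.Dom → Type*} [∀ X, SeminormedAddCommGroup (W X)]
    (Q : (X : S.Dom) → W X → W X → ℝ) (h h' : (X : S.Dom) → Λ → W X) (E2 E2' : S.Dom → Λ → Λ → ℝ) {A B₃ κ δ₀ η : ℝ}
    (hA : 0 ≤ A) (hB₃ : 0 ≤ B₃) (hη : 0 ≤ η) (hδ₀ : 0 ≤ δ₀)
    (hrepr : ∀ X x y, E2 X x y = Q X (h X x) (h X y)) (hrepr' : ∀ X x y, E2' X x y = Q X (h' X x) (h' X y))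
    (hQ : ∀ X (a b a' b' : W X), |Q X a' b' - Q X a b| ≤ A * Real.exp (-κ * S.dj X) * (‖a' - a‖ * ‖b'‖ + ‖a‖ * ‖b' - b‖))
    (hh : ∀ X x, ‖h X x‖ ≤ B₃ * Real.exp (-δ₀ * G.distD x X))
    (hcmp : ∀ X x, ‖h' X x - h X x‖ ≤ η * Real.exp (-(δ₀ / 2) * G.distD x X)) :
    KernelBound G (fun X x y => E2' X x y - E2 X x y) (A * η * ((B₃ + η) + B₃)) κ (δ₀ / 2) :=
  kernelBound_twoVolume_of_size_subadd G (fun _ a => ‖a‖) (fun _ _ => norm_nonneg _) (fun _ _ _ => norm_add_le _ _) Q h h' E2 E2' hA hB₃ hη hδ₀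
    hrepr hrepr' hQ hh hcmp

/-- The Lipschitz-bilinear hypothesis `hQ` of `kernelBound_twoVolume_of_repr435` from GENUINE bilinearity + the Cauchy bound `|Q_X(a, b)| ≤ A e^{−κd_j(X)}‖a‖‖b‖`
(`Q_X(a′, b′) − Q_X(a, b) = Q_X(a′ − a, b′) + Q_X(a, b′ − b)`). [cite: Balaban1987RG1, (4.3)–(4.5) pp.281–282 (bookkeeping)] -/
theorem lipschitz_of_bilinear_cauchy {W : S.Dom → Type*} [∀ X, SeminormedAddCommGroup (W X)] [∀ X, NormedSpace ℝ (W X)]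
    (Q : (X : S.Dom) → W X →ₗ[ℝ] W X →ₗ[ℝ] ℝ) {A κ : ℝ}
    (hQ : ∀ X (a b : W X), |Q X a b| ≤ A * Real.exp (-κ * S.dj X) * ‖a‖ * ‖b‖) (X : S.Dom) (a b a' b' : W X) :
    |Q X a' b' - Q X a b| ≤ A * Real.exp (-κ * S.dj X) * (‖a' - a‖ * ‖b'‖ + ‖a‖ * ‖b' - b‖) := by
  have e : Q X a' b' - Q X a b = Q X (a' - a) b' + Q X a (b' - b) := by
    simp only [map_sub, LinearMap.sub_apply]; ring
  rw [e]
  calc |Q X (a' - a) b' + Q X a (b' - b)| ≤ |Q X (a' - a) b'| + |Q X a (b' - b)| := abs_add_le _ _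
    _ ≤ A * Real.exp (-κ * S.dj X) * ‖a' - a‖ * ‖b'‖ + A * Real.exp (-κ * S.dj X) * ‖a‖ * ‖b' - b‖ := add_le_add (hQ X _ _) (hQ X _ _)
    _ = A * Real.exp (-κ * S.dj X) * (‖a' - a‖ * ‖b'‖ + ‖a‖ * ‖b' - b‖) := by ring

/-- Bilinearity of `∂²` at an analytic point: `∂²E[a′, b′] − ∂²E[a, b] = ∂²E[a′ − a, b′] + ∂²E[a, b′ − b]` (`mixedDeriv E a b = D²E(0)[b][a]`,
`Beta.RemainderLocality.mixedDeriv_eq_fderiv_fderiv`). [cite: Balaban1987RG1, (4.3) p.281 (bookkeeping)] -/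
theorem mixedDeriv_sub_mixedDeriv {W : Type*} [NormedAddCommGroup W] [NormedSpace ℂ W] {E : W → ℂ} (hE : AnalyticAt ℂ E 0) (a b a' b' : W) :
    mixedDeriv E a' b' - mixedDeriv E a b = mixedDeriv E (a' - a) b' + mixedDeriv E a (b' - b) := by
  have hd := differentiableAt_fderiv_of_analyticAt hE
  simp only [mixedDeriv_eq_fderiv_fderiv hd, map_sub, FunLike.coe_sub, Pi.sub_apply]
  ring

/-- ★★ **(4a) IN THE TREE ENGINE'S OWN CURRENCY** (the GAUGE of print's (4.4) domain, exactly the setting of `B12Decay510Gauge.kernelBound_of_gauge` which the decay join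
`PortH.abs_polComp_diag_le_of_rows` ∕ `decay510_plimOf_of_rows_trace` runs per volume): pieces `EX X` analytic on a convex balanced open `D X ∋ 0` with (1.18) there; member `n`'s
kernel `E2 X x y = Re ∂²(EX X)[h_X x, h_X y]` and member `n + 1`'s kernel PULLED BACK to member `n`'s domains and coordinates `E2′ X x y = Re ∂²(EX X)[h′_X x, h′_X y]` (SAME `EX X`:
`PieceVolIndep` + (R5) + `mixedDeriv_comp_clm`; `h′_X x = cutTo (cX n X) (fun i => Gk (n+1) (e (n+1) μ z) (jX n X i))` by (R3)); gauge decay of member `n`'s response ((R1ᴰ)) and the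
(R4ᴰ) comparison `gauge (D X) (h′_X x − h_X x) ≤ η e^{−(δ₀∕2)dist(x,X)}` ⟹ `KernelBound G (E2′ − E2) (16E₀η(2Bh + η)) κ (δ₀∕2)` (NO member-`n + 1` decay transfer: `h′`'s gauge bound comes from (R1ᴰ)ₙ + (R4ᴰ) by `gauge_add_le`).  With
`B12Decay510.abs_twoPoint_le` (leaves at `(κ∕2, δ₀∕4)`): `|Σ_X (E2′ − E2)(X,x,y)| ≤ 16E₀η(2Bh + η)·e^{δ₁′Mc₁}K₀K₁·e^{−δ₁′ρ(x,y)}`, `δ₁′ = delta1 (δ₀∕2) κ M`.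
[cite: Balaban1987RG1, (4.4)–(4.5) pp.281–282, (4.35) p.290, (1.21) p.264; Balaban1985Variational, Prop. 9 p.309] -/
theorem kernelBound_twoVolume_of_gauge {W : Type*} [NormedAddCommGroup W] [NormedSpace ℂ W] (G : SiteGeometry C Λ) (EX : S.Dom → W → ℂ) (D : S.Dom → Set W)
    (h h' : S.Dom → Λ → W) (E2 E2' : S.Dom → Λ → Λ → ℝ) {E₀ Bh κ δ₀ η : ℝ} (hE₀ : 0 ≤ E₀) (hBh : 0 ≤ Bh) (hη : 0 ≤ η) (hδ₀ : 0 ≤ δ₀)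
    (hD : ∀ X, Convex ℝ (D X) ∧ Balanced ℂ (D X) ∧ IsOpen (D X) ∧ (0 : W) ∈ D X)
    (han : ∀ X, AnalyticOnNhd ℂ (EX X) (D X))
    (h118 : ∀ X, ∀ w ∈ D X, ‖EX X w‖ ≤ E₀ * Real.exp (-κ * S.dj X))
    (hrepr : ∀ X x y, E2 X x y = (mixedDeriv (EX X) (h X x) (h X y)).re)
    (hrepr' : ∀ X x y, E2' X x y = (mixedDeriv (EX X) (h' X x) (h' X y)).re)
    (hh : ∀ X x, gauge (D X) (h X x) ≤ Bh * Real.exp (-δ₀ * G.distD x X))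
    (hcmp : ∀ X x, gauge (D X) (h' X x - h X x) ≤ η * Real.exp (-(δ₀ / 2) * G.distD x X)) :
    KernelBound G (fun X x y => E2' X x y - E2 X x y) (16 * E₀ * η * ((Bh + η) + Bh)) κ (δ₀ / 2) := by
  refine kernelBound_twoVolume_of_size_subadd G (W := fun _ => W) (fun X a => gauge (D X) a) (fun _ a => gauge_nonneg a)
    (fun X a b => gauge_add_le (hD X).1 (absorbent_nhds_zero ((hD X).2.2.1.mem_nhds (hD X).2.2.2)) a b)
    (fun X a b => (mixedDeriv (EX X) a b).re) h h' E2 E2' (by positivity) hBh hη hδ₀ hrepr hrepr' ?_ hh hcmp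
  intro X a b a' b'
  have hE : AnalyticAt ℂ (EX X) 0 := han X 0 (hD X).2.2.2
  have hc := fun u v => norm_mixedDeriv_le_gauge (hD X).1 (hD X).2.1 (hD X).2.2.1 (hD X).2.2.2 (han X) (h118 X) u v
  rw [← Complex.sub_re, mixedDeriv_sub_mixedDeriv hE]
  calc |(mixedDeriv (EX X) (a' - a) b' + mixedDeriv (EX X) a (b' - b)).re|
      ≤ ‖mixedDeriv (EX X) (a' - a) b' + mixedDeriv (EX X) a (b' - b)‖ := Complex.abs_re_le_norm _
    _ ≤ ‖mixedDeriv (EX X) (a' - a) b'‖ + ‖mixedDeriv (EX X) a (b' - b)‖ := norm_add_le _ _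
    _ ≤ 16 * (E₀ * Real.exp (-κ * S.dj X)) * gauge (D X) (a' - a) * gauge (D X) b' +
          16 * (E₀ * Real.exp (-κ * S.dj X)) * gauge (D X) a * gauge (D X) (b' - b) := add_le_add (hc _ _) (hc _ _)
    _ = 16 * E₀ * Real.exp (-κ * S.dj X) * (gauge (D X) (a' - a) * gauge (D X) b' + gauge (D X) a * gauge (D X) (b' - b)) := by ring

/-- ★ **(4a-core) THE PULL-BACK IDENTITY**: with volume-blind pieces (`PieceVolIndep`: `EX′ u′ = EX (πc u′)`) and the chart intertwining ((R5): `πc (χ′ w′) = χ (R w′)`, `R = restrictCLM cX jX`),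
member `n + 1`'s charted piece at `emb X` IS member `n`'s charted piece composed with the ℂ-linear restriction `R`, so its (4.35) term is member `n`'s FORM at the pulled-back inputs:
`∂²(EX′ ∘ χ′)[a′, b′] = ∂²(EX ∘ χ)[R a′, R b′]` (`Beta.RemainderLocality.mixedDeriv_comp_clm`).  This is what feeds `hrepr′` of `kernelBound_twoVolume_of_gauge` with
`h′_X x := R (cutTo cX′ (Gk (n+1) x′)) = cutTo (cX n X) (fun i => Gk (n+1) (e (n+1) μ z) (jX n X i))` (by (R3)). [cite: Balaban1987RG1, (1.7) p.261, (4.35) p.290, (1.21) p.264] -/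
theorem mixedDeriv_nextMember_eq {W W' P P' : Type*} [NormedAddCommGroup W] [NormedSpace ℂ W] [NormedAddCommGroup W'] [NormedSpace ℂ W']
    (EX : P → ℂ) (EX' : P' → ℂ) (χ : W → P) (χ' : W' → P') (πc : P' → P) (R : W' →L[ℂ] W)
    (hV : ∀ u', EX' u' = EX (πc u')) (hI : ∀ w', πc (χ' w') = χ (R w'))
    {D : Set W} (ho : IsOpen D) (h0 : (0 : W) ∈ D) (han : AnalyticOnNhd ℂ (fun w => EX (χ w)) D) (a b : W') :
    mixedDeriv (fun w' => EX' (χ' w')) a b = mixedDeriv (fun w => EX (χ w)) (R a) (R b) := by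
  have hfun : (fun w' => EX' (χ' w')) = fun w' => (fun w => EX (χ w)) (R w') := by
    funext w'
    simp only [hV, hI]
  rw [hfun]
  obtain ⟨r, hr, hball⟩ := Metric.isOpen_iff.1 ho 0 h0
  exact mixedDeriv_comp_clm hr (fun y hy => (han y (hball hy)).differentiableAt) R a b

end TwoVolume

/-! ## §8 (4c) generic: the TAILS of the volume increment are masked `KernelBound`s with a small constant (large domains: the wrap class; far domains: outside the window) -/

section Tails

open Literature.MathematicalPhysics.QuantumFieldTheory.Balaban1983to89.B12Decay510 (SiteGeometry KernelBound)

variable {S : LocDomainSys} {C : B12.CubeCover S} {Λ : Type*}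

/-- The kernel MASKED to a class `P` of domains (zero elsewhere): `Σ_{X ∈ P} |E2 X x y| = Σ_X |maskKernel E2 P X x y|`. [cite: Balaban1987RG1, (4.37) p.290 (bookkeeping)] -/
def maskKernel (E2 : S.Dom → Λ → Λ → ℝ) (P : S.Dom → Prop) [DecidablePred P] : S.Dom → Λ → Λ → ℝ :=
  fun X x y => if P X then E2 X x y else 0

/-- The filtered absolute sum IS the absolute sum of the masked kernel. [cite: Balaban1987RG1, (4.37) p.290 (bookkeeping)] -/
theorem sum_filter_abs_eq_sum_abs_maskKernel [Fintype S.Dom] (E2 : S.Dom → Λ → Λ → ℝ) (P : S.Dom → Prop) [DecidablePred P] (x y : Λ) :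
    ∑ X ∈ Finset.univ.filter P, |E2 X x y| = ∑ X, |maskKernel E2 P X x y| := by
  rw [Finset.sum_filter]
  refine Finset.sum_congr rfl fun X _ => ?_
  unfold maskKernel
  split_ifs <;> simp

/-- **LARGE-DOMAIN TAIL** (the wrap class of member `n`: a wrapping domain has `d_j(X)` of the order of the torus, so `e^{−(κ∕2)d_j(X)} ≤ ε := e^{−(κ∕2)c·N}`): on a class where
`e^{−(κ∕2)d_j(X)} ≤ ε`, the masked kernel obeys `KernelBound` with constant `CE·ε` at the halved tree rate `κ∕2` — so `B12Decay510.sum_abs_le` (TreeLeaf at `κ∕4`) bounds the tail by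
`CE·ε·e^{δ₁Mc₁}K₀K₁`. [cite: Balaban1987RG1, (1.18) p.263, (4.37) p.290, (5.10) p.293] -/
theorem kernelBound_maskKernel_of_large (G : SiteGeometry C Λ) {E2 : S.Dom → Λ → Λ → ℝ} {CE κ δ₀ ε : ℝ} (hCE : 0 ≤ CE) (hε : 0 ≤ ε)
    (hE : KernelBound G E2 CE κ δ₀) (P : S.Dom → Prop) [DecidablePred P] (hP : ∀ X, P X → Real.exp (-(κ / 2) * S.dj X) ≤ ε) :
    KernelBound G (maskKernel E2 P) (CE * ε) (κ / 2) δ₀ := by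
  intro X x y
  unfold maskKernel
  split_ifs with hX
  · have hsplit : Real.exp (-κ * S.dj X) = Real.exp (-(κ / 2) * S.dj X) * Real.exp (-(κ / 2) * S.dj X) := by
      rw [← Real.exp_add]; ring_nf
    have ha : Real.exp (-(κ / 2) * S.dj X) * Real.exp (-(κ / 2) * S.dj X) ≤ ε * Real.exp (-(κ / 2) * S.dj X) :=
      mul_le_mul_of_nonneg_right (hP X hX) (Real.exp_pos _).le
    have hb : CE * Real.exp (-κ * S.dj X) ≤ CE * ε * Real.exp (-(κ / 2) * S.dj X) := by
      rw [hsplit]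
      calc CE * (Real.exp (-(κ / 2) * S.dj X) * Real.exp (-(κ / 2) * S.dj X)) ≤ CE * (ε * Real.exp (-(κ / 2) * S.dj X)) :=
            mul_le_mul_of_nonneg_left ha hCE
        _ = CE * ε * Real.exp (-(κ / 2) * S.dj X) := by ring
    calc |E2 X x y| ≤ CE * Real.exp (-κ * S.dj X) * Real.exp (-δ₀ * G.distD x X) * Real.exp (-δ₀ * G.distD y X) := hE X x y
      _ ≤ CE * ε * Real.exp (-(κ / 2) * S.dj X) * Real.exp (-δ₀ * G.distD x X) * Real.exp (-δ₀ * G.distD y X) :=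
          mul_le_mul_of_nonneg_right (mul_le_mul_of_nonneg_right hb (Real.exp_pos _).le) (Real.exp_pos _).le
  · rw [abs_zero]
    exact mul_nonneg (mul_nonneg (mul_nonneg (mul_nonneg hCE hε) (Real.exp_pos _).le) (Real.exp_pos _).le) (Real.exp_pos _).le

/-- **FAR-DOMAIN TAIL** (the domains of member `n + 1` that are NOT images of member-`n` domains lie outside the embedded window, at distance `≥ R` from every label of the inner window,
so `e^{−(δ₀∕2)dist(x, X)} ≤ ε := e^{−(δ₀∕2)R}` for ALL labels `x` of the geometry — instantiate the label type with the inner window via `SiteGeometry.comapLabels`): the masked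
kernel obeys `KernelBound` with constant `CE·ε` at the halved response rate `δ₀∕2`. [cite: Balaban1987RG1, (4.5) p.282, (4.37) p.290, (5.10) p.293] -/
theorem kernelBound_maskKernel_of_far (G : SiteGeometry C Λ) {E2 : S.Dom → Λ → Λ → ℝ} {CE κ δ₀ ε : ℝ} (hCE : 0 ≤ CE) (hε : 0 ≤ ε) (hδ₀ : 0 ≤ δ₀)
    (hE : KernelBound G E2 CE κ δ₀) (P : S.Dom → Prop) [DecidablePred P] (hP : ∀ X, P X → ∀ x : Λ, Real.exp (-(δ₀ / 2) * G.distD x X) ≤ ε) :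
    KernelBound G (maskKernel E2 P) (CE * ε) κ (δ₀ / 2) := by
  intro X x y
  unfold maskKernel
  split_ifs with hX
  · set eκ := Real.exp (-κ * S.dj X)
    set ex := Real.exp (-(δ₀ / 2) * G.distD x X)
    set ey := Real.exp (-(δ₀ / 2) * G.distD y X)
    have hx2 : Real.exp (-δ₀ * G.distD x X) = ex * ex := by rw [← Real.exp_add]; ring_nf
    have hy2 : Real.exp (-δ₀ * G.distD y X) = ey * ey := by rw [← Real.exp_add]; ring_nf
    have hey1 : ey ≤ 1 := Real.exp_le_one_iff.mpr (by nlinarith [G.distD_nonneg y X])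
    have h0 : 0 ≤ CE * eκ := mul_nonneg hCE (Real.exp_pos _).le
    calc |E2 X x y| ≤ CE * eκ * Real.exp (-δ₀ * G.distD x X) * Real.exp (-δ₀ * G.distD y X) := hE X x y
      _ = CE * eκ * (ex * ex) * (ey * ey) := by rw [hx2, hy2]
      _ ≤ CE * eκ * (ε * ex) * (1 * ey) := by
          refine mul_le_mul (mul_le_mul_of_nonneg_left (mul_le_mul_of_nonneg_right (hP X hX x) (Real.exp_pos _).le) h0) ?_
            (mul_nonneg (Real.exp_pos _).le (Real.exp_pos _).le) (mul_nonneg h0 (mul_nonneg hε (Real.exp_pos _).le))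
          exact mul_le_mul_of_nonneg_right hey1 (Real.exp_pos _).le
      _ = CE * ε * eκ * ex * ey := by ring
  · rw [abs_zero]
    exact mul_nonneg (mul_nonneg (mul_nonneg (mul_nonneg hCE hε) (Real.exp_pos _).le) (Real.exp_pos _).le) (Real.exp_pos _).le

/-- Restricting the LABELS of a site geometry along a map (e.g. the inclusion of the inner window's labels). [cite: Balaban1987RG1, §0 p.257 (bookkeeping)] -/
def comapLabels {Λ₀ : Type*} (G : SiteGeometry C Λ) (f : Λ₀ → Λ) : SiteGeometry C Λ₀ where
  distC x c := G.distC (f x) c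
  distD x X := G.distD (f x) X
  distC_nonneg _ _ := G.distC_nonneg _ _
  distD_nonneg _ _ := G.distD_nonneg _ _
  pick x X := G.pick (f x) X
  pick_mem _ _ := G.pick_mem _ _
  distC_pick_le _ _ := G.distC_pick_le _ _

/-- A kernel bound restricts along the labels. [cite: Balaban1987RG1, (4.5) p.282 (bookkeeping)] -/
theorem kernelBound_comapLabels {Λ₀ : Type*} (G : SiteGeometry C Λ) (f : Λ₀ → Λ) {E2 : S.Dom → Λ → Λ → ℝ} {CE κ δ₀ : ℝ}
    (hE : KernelBound G E2 CE κ δ₀) : KernelBound (comapLabels G f) (fun X x y => E2 X (f x) (f y)) CE κ δ₀ :=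
  fun X x y => hE X (f x) (f y)

end Tails

/-! ## §9 (4a)+(4c) bookkeeping: the two-volume increment SPLITS into the matched part (off the wrap class, through the embedding) and the two tails -/

section Split

/-- ★ **THE THREE-TERM SPLIT of the volume increment** (pure bookkeeping): member `n + 1`'s polymer sum minus member `n`'s is bounded by the MATCHED differences off the exceptional
class `P` (= wrap; `emb` injective there), plus member `n`'s wrap-class tail, plus member `n + 1`'s sum over the domains that are NOT images — the three pieces that
`kernelBound_twoVolume_of_gauge`, `kernelBound_maskKernel_of_large` and `kernelBound_maskKernel_of_far` turn into `KernelBound`s for `B12Decay510.sum_abs_le`.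
[cite: Balaban1987RG1, (1.21) p.264 with (1.7) p.261 and (4.37) p.290 (bookkeeping)] -/
theorem abs_sum_next_sub_sum_le_three {ι ι' : Type*} [Fintype ι] [Fintype ι'] [DecidableEq ι'] (a : ι → ℝ) (b : ι' → ℝ) (emb : ι → ι')
    (P : ι → Prop) [DecidablePred P] (hinj : Set.InjOn emb {i | ¬P i}) :
    |∑ i', b i' - ∑ i, a i| ≤ (∑ i ∈ Finset.univ.filter (fun i => ¬P i), |b (emb i) - a i|) + (∑ i ∈ Finset.univ.filter P, |a i|) +
      ∑ i' ∈ Finset.univ.filter (fun i' => i' ∉ (Finset.univ.filter (fun i => ¬P i)).image emb), |b i'| := by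
  classical
  set good : Finset ι := Finset.univ.filter (fun i => ¬P i) with hgood
  set img : Finset ι' := good.image emb with himg
  have hinj' : Set.InjOn emb (good : Set ι) := by
    intro i hi j hj h
    exact hinj (by simpa [hgood] using hi) (by simpa [hgood] using hj) h
  -- split member n + 1's sum along `img`, member n's along `P`
  have hb : ∑ i', b i' = (∑ i' ∈ img, b i') + ∑ i' ∈ Finset.univ.filter (fun i' => i' ∉ img), b i' := by
    rw [← Finset.sum_filter_add_sum_filter_not Finset.univ (fun i' => i' ∈ img)]
    congr 1
    exact Finset.sum_congr (by ext i'; simp) fun _ _ => rfl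
  have hbimg : ∑ i' ∈ img, b i' = ∑ i ∈ good, b (emb i) := Finset.sum_image hinj'
  have ha : ∑ i, a i = (∑ i ∈ good, a i) + ∑ i ∈ Finset.univ.filter P, a i := by
    rw [← Finset.sum_filter_add_sum_filter_not Finset.univ (fun i => ¬P i)]
    congr 1
    exact Finset.sum_congr (by ext i; simp) fun _ _ => rfl
  have key : ∑ i', b i' - ∑ i, a i =
      (∑ i ∈ good, (b (emb i) - a i)) - (∑ i ∈ Finset.univ.filter P, a i) + ∑ i' ∈ Finset.univ.filter (fun i' => i' ∉ img), b i' := by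
    rw [hb, hbimg, ha, Finset.sum_sub_distrib]; ring
  rw [key]
  calc |(∑ i ∈ good, (b (emb i) - a i)) - (∑ i ∈ Finset.univ.filter P, a i) + ∑ i' ∈ Finset.univ.filter (fun i' => i' ∉ img), b i'|
      ≤ |(∑ i ∈ good, (b (emb i) - a i)) - ∑ i ∈ Finset.univ.filter P, a i| + |∑ i' ∈ Finset.univ.filter (fun i' => i' ∉ img), b i'| := abs_add_le _ _
    _ ≤ (|∑ i ∈ good, (b (emb i) - a i)| + |∑ i ∈ Finset.univ.filter P, a i|) + |∑ i' ∈ Finset.univ.filter (fun i' => i' ∉ img), b i'| := by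
        gcongr; exact abs_sub _ _
    _ ≤ (∑ i ∈ good, |b (emb i) - a i|) + (∑ i ∈ Finset.univ.filter P, |a i|) + ∑ i' ∈ Finset.univ.filter (fun i' => i' ∉ img), |b i'| := by
        gcongr
        · exact Finset.abs_sum_le_sum_abs _ _
        · exact Finset.abs_sum_le_sum_abs _ _
        · exact Finset.abs_sum_le_sum_abs _ _

end Split

end Literature.MathematicalPhysics.QuantumFieldTheory.Balaban1983to89.B12Decay510TwoVolume

end
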